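import Summits.QuantumFields.QCD.Theses.HeatSlicedQuarks
import Summits.QuantumFields.QCD.Theses.NestedDissectionSea
import Summits.QuantumFields.QCD.Theorems.HeatSlicedQuarksInterleavedFlowProperStubFormatHandover
import Summits.QuantumFields.QCD.Theorems.HeatSlicedQuarksInterleavedFlowProperStubCoerciveFormatInstantiate
import Summits.QuantumFields.QCD.Theorems.HeatSlicedQuarksInterleavedFlowProperStubPolynomialFiniteRange
import Summits.QuantumFields.QCD.Theorems.HeatSlicedQuarksInterleavedFlowProperStubFineWeightAdmissible
import Summits.QuantumFields.QCD.Theorems.HeatSlicedQuarksInterleavedFlowProperStubOffsetMeetsThreshold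
import Summits.QuantumFields.QCD.Theorems.HeatSlicedQuarksInterleavedFlowProperStubHeavyTailSliceBound
import Summits.QuantumFields.QCD.Theorems.HeatSlicedQuarksInterleavedFlowProperStubDiagonalExtraction
import Summits.QuantumFields.QCD.Theorems.HeatSlicedQuarksInterleavedHeatSliceFlowCollapse
import Summits.QuantumFields.QCD.Theorems.RobustYangMillsHandover.Negative.GapClauses

/-!
# Line `Sketch` — skeleton gen 4 (continuation lead c2; gen 3 = lead c1) for crux stmt-QuantumFields-18031
# `Summit.QuantumFields.QCD.Theses.HeatSlicedQuarks.InterleavedFlowProper`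

`InterleavedFlowProper := TracedQuadraticParametrix → QuarkLoopCoefficient → InterleavedHeatSliceFlow`, and
`InterleavedHeatSliceFlow ↔ ContinuumQCDExists` (p96451), so the crux is ≡ X₀ modulo the two CLOSED milestones
(17985, 16786).  Composition (card `offset-last-format-handover`, gen-2 shape of the previous lead, re-established
here because the gen-2 file is not readable from this seat):

  provable inputs ─► K1b `stub_blockFormat` (interleaved flow ⇒ the all-axes-AP quark-integrated Wilson weight is in
  rev-3 COERCIVE Bałaban format: `CoerciveFormatMembership`, whose seven fine clauses are PROVED, `stubFW_admissible`)
  ─► `coerciveFormat_instantiate` (PROVED below: rev-3 quantifier match with `Theses.NestedDissectionSea.RobustYangMillsRG`)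
  fed by `stub_robustYangMillsRG` (= item stmt-QuantumFields-17812 BY NAME) ─► `BlockGapAlongQCDWeight`
  ─► KΩ `stub_continuumPackage` (OS limit of the periodic-quark functional along one subsequence, SO(4), non-triviality)
  ─► `QCDLimitsAlongOneSubsequence` ─► (landed `thresholdContinuumQCDExists_of_limitsAlong`) threshold X₀
  ─► (tree `continuumQCDExists_iff_threshold`) X₀ ─► crux.

Gen 4 (lead c2): KΩ `stub_continuumPackage` is split into its analytic core KΩ′ `stub_locallyUniformLimits` (target
`LocallyUniformQCDLimits`: limits locally uniformly in the mass tuple, from every subsequence) and the purely logical K4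
step `limitsAlong_of_locallyUniform` (one extraction for all tuples; Lindelöf + diagonal; LANDED p156652).

Stubs (sorries ONLY here): `stub_blockFormat` (K1b, crux-sized), `stub_robustYangMillsRG` (other route's crux 17812 by name, typed against the
`NestedDissectionSea` copy of the decl, which is the one the Lean farm serves at rev 3 — the `HeavyThresholdYMBridge` copy is
textually identical on the hub but the farm still serves its rev-2 olean, finding F4 of the gen-2 lead, still true at 10:00Z),
`stub_locallyUniformLimits` (KΩ′, crux-sized).  LANDED in gen 4: `limitsAlong_of_locallyUniform` (K4, p156652).  NOT registered: ideator 2's `FiniteRangeHeatSlices` — as typed it is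
junk-inhabited (all pieces zero except `Φ L := (H_U + μ²)⁻¹`, whose range and size clauses are void since `torusDist < L < 2^L`;
certificate `work/FiniteRangeHeatSlicesVacuous.lean`, finding F5); the contentful FRD needs size bounds on EVERY piece
including the top/zero-mode piece and is not an input this skeleton pretends to have.
-/

noncomputable section

namespace Summit.QuantumFields.QCD.Cruxes.InterleavedFlowProper.OffsetLastFormatHandover

open Summit.QuantumFields.QCD.Theses.HeatSlicedQuarks
open Literature.MathematicalPhysics.QuantumFieldTheory Literature.MathematicalPhysics.QuantumLattice
  Literature.MathematicalPhysics.AQFT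
open Literature.Probability.LatticeModels (TorusSite)
open Filter Topology MeasureTheory
open scoped Matrix ComplexOrder

/-! ## §1 Provable input of K1b (ideator 2, card `finite-range-heat-slices`, structural core) -/

-- `stub_polynomialFiniteRange` (Chebyshev finite range: a polynomial of degree `d` in `H_U = D_Wᴴ D_W` vanishes beyond torus
-- distance `2d`) is LANDED (p154388, `Theorems/HeatSlicedQuarksInterleavedFlowProperStubPolynomialFiniteRange.lean`) and imported.

/-! ## §2 K1b — the research core -/

/-- Registered stub (K1b, crux-sized research core): the interleaved Bałaban-SU(3)/fermionic-slice flow, run at the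
quark-shifted coupling above the offset chosen LAST (`stub_offsetMeetsThreshold`), with U-uniform massive last slice
(`stub_heavyTailSliceBound`), exactly finite-range polynomial slices of `H_U` (`stub_polynomialFiniteRange`, LANDED p154388 — the
structural core of a Bauerschmidt finite-range decomposition of the quark Green form) and the two milestones as size frame /
marginal coefficient, places the all-axes-antiperiodic quark-integrated Wilson weight in rev-3 COERCIVE Bałaban format with
the lever's quantifier order — `CoerciveFormatMembership` (its seven fine clauses are the landed `stubFW_admissible`; the
open content is the block half: convergent `βe`, measurable covariant local `Bl`, coercive analytic `A`, small `W`, rough `F`,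
exact pushforward identity).  No theorem of this shape exists for a dynamical non-abelian gauge field in `d = 4`. -/
theorem stub_blockFormat :
    (∀ (L : ℕ) [NeZero L] (U : GaugeConfig 4 L (Matrix.specialUnitaryGroup (Fin 3) ℂ)) (m : ℝ)
      (p : Polynomial ℂ) (x y : TorusSite 4 L × Fin 3 × Fin 4),
      2 * p.natDegree < torusDist x.1 y.1 →
        (Polynomial.aeval ((wilsonDirac (fundamentalRep (Fin 3)) U m 1)ᴴ * wilsonDirac (fundamentalRep (Fin 3)) U m 1) p)
          x y = 0) →
    TracedQuadraticParametrix → QuarkLoopCoefficient → CoerciveFormatMembership := by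
  sorry

/-! ## §3 The rev-3 handover (proved) and the YM-side input (item 17812 by name) -/

-- `coerciveFormat_instantiate : NestedDissectionSea.RobustYangMillsRG → CoerciveFormatMembership → BlockGapAlongQCDWeight`
-- is LANDED (p153753, `Theorems/HeatSlicedQuarksInterleavedFlowProperStubCoerciveFormatInstantiate.lean`) and imported.

/-- Registered stub: the YM-side named condition, item stmt-QuantumFields-17812 BY NAME (open; another route's crux). -/
theorem stub_robustYangMillsRG : Theses.NestedDissectionSea.RobustYangMillsRG := by
  sorry

/-! ## §4 KΩ — the continuum package (line-side since rev 3), gen 4: the analytic core KΩ′ and the logical step K4 apart -/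

-- `LocallyUniformQCDLimits` (the KΩ′ target: limits locally uniformly in the mass tuple, from every subsequence) and the K4
-- stub `limitsAlong_of_locallyUniform : LocallyUniformQCDLimits → QCDLimitsAlongOneSubsequence` (Lindelöf + diagonal) are
-- LANDED (p156652, `Theorems/HeatSlicedQuarksInterleavedFlowProperStubDiagonalExtraction.lean`) and imported.

/-- Registered stub (KΩ′, crux-sized, the analytic core of the continuum package): from the block gap along the QCD
weight (and re-entering the flow for sub-`ℓ₀` observables, hence the milestones repeated) to `k`-uniform bounds on all
smeared `n`-point functions of X₀'s PERIODIC-quark functional (incl. the AP–periodic comparison K5 and the quark-line Wick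
bookkeeping K3), their local Lipschitz/equicontinuity in the mass tuple, subsequential limits from every subsequence, and
the OS axioms E0–E4 of every limit including full `SO(4)` invariance, non-triviality / non-Gaussianity of glue and of
every `pseudoRe f g` — delivered in the locally-`m`-uniform, from-every-subsequence form `LocallyUniformQCDLimits`. -/
theorem stub_locallyUniformLimits :
    TracedQuadraticParametrix → QuarkLoopCoefficient → BlockGapAlongQCDWeight → LocallyUniformQCDLimits := by
  sorry

/-! ## §5 Composition -/

/-- The threshold form of X₀ used by the landing pad IS the tree's inline threshold form. -/
theorem continuumQCDExists_of_threshold (h : ThresholdContinuumQCDExists) : ContinuumQCDExists :=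
  Theorems.RobustYangMillsHandover.Negative.continuumQCDExists_iff_threshold.mpr h

/-- **Composition**: the stubs close the crux BY NAME. -/
theorem InterleavedFlowProper_of : InterleavedFlowProper := by
  intro hTQP hQLC
  have hfmt : CoerciveFormatMembership :=
    stub_blockFormat stub_polynomialFiniteRange hTQP hQLC
  have hgap : BlockGapAlongQCDWeight := coerciveFormat_instantiate stub_robustYangMillsRG hfmt
  have hlim : QCDLimitsAlongOneSubsequence :=
    limitsAlong_of_locallyUniform (stub_locallyUniformLimits hTQP hQLC hgap)
  have hX₀ : ContinuumQCDExists :=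
    continuumQCDExists_of_threshold (thresholdContinuumQCDExists_of_limitsAlong hlim)
  exact Cruxes.InterleavedHeatSliceFlow.interleavedHeatSliceFlow_iff_continuumQCDExists.mpr hX₀

end Summit.QuantumFields.QCD.Cruxes.InterleavedFlowProper.OffsetLastFormatHandover

end
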